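import Summits.Ventures.HodgeRepro.Night4ReducedDimTwelve
import Summits.Ventures.HodgeRepro.Night4ReducedDimTransport

/-!
# Beyond the census faces: `dim B_red` of every conjugate-free `SumTwo` quadruple, the method

Blind re-derivation cell `pub-hodge-repro`, seat `night-4` (ROUTE HARDENING for the Monday FINAL, gen 5).  Target tree
path `lean/Summits/Ventures/HodgeRepro/Night4ReducedDimQuads.lean`.

ROUTE.md v2.89 §3.1: «in degree 6 (pattern (1,1,1)) and degree 8 (pattern (2,1,1)) the census faces are ALL the
(eq2)-quadruples without conjugate corners; in degree 12 the patterns (3,2,1) and (2,2,2) also occur and are NOT census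
faces»; §3.4 counts them («102 / 108 / 118 / 102 non-census classes per group») but tabulates `dim B_red` for the census
faces only.  The exceptional `(2,2)`-classes of the route are all the conjugate-free `SumTwo` quadruples of CM types
(§3.6, Lemma L / P: the zero-sum lattice is generated by pairs and census faces, but every such quadruple is an
instance of S4 on its own corner product), so their reduced dimensions are the complete «smallest open objects» table
of a degree.  This file gives the method — the bridge from a Boolean table to every such quadruple — and
`Night4ReducedDimQuadWitnesses.lean` certifies the new values it finds in degree 12 on explicit quadruples.  The full
tables were MEASURED, not run: in `Finset` arithmetic the kernel needs ≈ 15 ms per enumerated candidate and ≈ 80 ms per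
`redDimFirst` (probes of 2 base types: 23 s / 43 s), i.e. ≈ 11 minutes per `(G, c)` of order 12 — beyond one file's
budget (a bit-mask engine, as the typer's `QuadEngine`, would be needed); the Python census stands in for the value sets.

* `ConjFree c T` — no corner is the conjugate of another (decidable); `fourth T₀ T₁ T₂` — the fourth corner forced by
  `SumTwo` (`SumTwo.three_eq_fourth`: the embeddings lying in exactly one of the first three);
* the invariances: `SumTwo.smul` / `ConjFree.smul` (a Galois translate of all four corners), `SumTwo.comp_perm` /
  `ConjFree.comp_perm` (relabelling the corners), with `redDim_smul` (Translate) and `redDim_comp_perm` (Transport);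
* `exists_perm_key_sorted`: relabel so that the `key`s of corners 1, 2, 3 are sorted (any `key : Finset G → ℕ`);
  `SumTwo.inter3_eq_empty` / `SumTwo.union3_eq_univ` (the cheap form of `SumTwo` once the fourth corner is forced),
  `Intersecting` / `ConjFree.intersecting` (the cheap form of `ConjFree` on CM types), **`SumTwo.two_eq`** (the third
  corner is `c (T₀ ∩ T₁) ∪ S ∪ c ((T₀ \ T₁) \ S)` for its trace `S` on the places where `T₀`, `T₁` differ — so only
  `2^{|T₀ \ T₁|}` third corners per pair, `msetAll` over the powerset: 3^6 = 729 candidates per `T₀` instead of 64²);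
* **`redDim_of_sumTwo_mem_of_all`** — the bridge: the Boolean table `quadTable` over `T₀ ∋ 1` (a list containing every
  such CM type), `T₁` (a list of all CM types), the enumerated `T₂` and `T₃ := fourth T₀ T₁ T₂` (`quadCheck`) gives
  `redDim T ∈ vals` for EVERY conjugate-free `SumTwo` quadruple `T` of CM types of `(G, c)`.

Nothing here says anything about the status of the Hodge conjecture for CM abelian varieties, which is NOT proved.
-/

set_option autoImplicit false

open Finset
open scoped Pointwise

namespace HodgeRepro

section Quads

variable {G : Type} [Group G] [Fintype G] [DecidableEq G]

/-- **No corner is the conjugate of another** (the quadruples whose Weil class is not a product of two divisor classes,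
ROUTE.md §3.1 / `NightOpenInputs.TypeDatum.IsFace`). -/
def ConjFree (c : G) (T : Fin 4 → Finset G) : Prop := ∀ i j : Fin 4, i ≠ j → T j ≠ c • T i

/-- `ConjFree` is decidable. -/
instance (c : G) (T : Fin 4 → Finset G) : Decidable (ConjFree c T) := by
  unfold ConjFree
  infer_instance

/-- The fourth corner forced by `SumTwo`: the embeddings lying in exactly one of the first three corners. -/
def fourth (T₀ T₁ T₂ : Finset G) : Finset G :=
  univ.filter fun g => (univ.filter fun i : Fin 3 => g ∈ ![T₀, T₁, T₂] i).card = 1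

omit [Group G] in
/-- In a `SumTwo` quadruple the fourth corner is determined by the first three. -/
theorem SumTwo.three_eq_fourth {T : Fin 4 → Finset G} (hT : SumTwo T) : T 3 = fourth (T 0) (T 1) (T 2) := by
  ext g
  have h := hT g
  rw [Finset.card_filter, Fin.sum_univ_four] at h
  simp only [fourth, mem_filter, mem_univ, true_and, Finset.card_filter, Fin.sum_univ_three,
    Matrix.cons_val_zero, Matrix.cons_val_one, Matrix.head_cons, Matrix.cons_val_two, Matrix.tail_cons]
  constructor
  · intro h3
    rw [if_pos h3] at h
    split_ifs at h ⊢ <;> omega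
  · intro h123
    by_contra h3
    rw [if_neg h3] at h
    split_ifs at h h123 <;> omega

/-- `SumTwo` is decidable on a finite group (named to avoid a clash with any instance of the typer's files). -/
instance night4DecidableSumTwo (T : Fin 4 → Finset G) : Decidable (SumTwo T) := by
  unfold SumTwo
  infer_instance

omit [Fintype G] in
/-- A Galois translate of a `SumTwo` quadruple is `SumTwo`. -/
theorem SumTwo.smul {T : Fin 4 → Finset G} (g : G) (hT : SumTwo T) : SumTwo (fun i => g • T i) := by
  intro x
  have e : (univ.filter fun i => x ∈ g • T i) = univ.filter fun i => g⁻¹ • x ∈ T i :=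
    Finset.filter_congr fun i _ => Finset.inv_smul_mem_iff.symm
  rw [e]
  exact hT _

omit [Fintype G] in
/-- A Galois translate of a conjugate-free quadruple is conjugate-free. -/
theorem ConjFree.smul {c : G} (hc : IsComplexConj c) {T : Fin 4 → Finset G} (g : G) (h : ConjFree c T) :
    ConjFree c (fun i => g • T i) := by
  intro i j hij e
  rw [hc.smul_comm_finset] at e
  exact h i j hij (MulAction.injective g e)

omit [Group G] [Fintype G] in
/-- Relabelling the corners keeps `SumTwo`. -/
theorem SumTwo.comp_perm {T : Fin 4 → Finset G} (σ : Equiv.Perm (Fin 4)) (hT : SumTwo T) : SumTwo (T ∘ σ) := by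
  intro x
  rw [← hT x]
  refine Finset.card_bij (fun i _ => σ i) (fun i hi => ?_) (fun i _ j _ h => σ.injective h) (fun j hj => ?_)
  · simp only [mem_filter, mem_univ, true_and, Function.comp_apply] at hi ⊢
    exact hi
  · refine ⟨σ.symm j, ?_, Equiv.apply_symm_apply σ j⟩
    simp only [mem_filter, mem_univ, true_and, Function.comp_apply, Equiv.apply_symm_apply] at hj ⊢
    exact hj

omit [Fintype G] in
/-- Relabelling the corners keeps conjugate-freeness. -/
theorem ConjFree.comp_perm {c : G} {T : Fin 4 → Finset G} (σ : Equiv.Perm (Fin 4)) (h : ConjFree c T) :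
    ConjFree c (T ∘ σ) :=
  fun i j hij e => h (σ i) (σ j) (fun e' => hij (σ.injective e')) e

omit [Group G] [Fintype G] [DecidableEq G] in
/-- Corners `1`, `2`, `3` can be relabelled (fixing corner `0`) so that their `key`s are sorted, for any
`key : Finset G → ℕ`: one of the six permutations of `{1, 2, 3}`. -/
theorem exists_perm_key_sorted (key : Finset G → ℕ) (T : Fin 4 → Finset G) :
    ∃ σ : Equiv.Perm (Fin 4), σ 0 = 0 ∧ key (T (σ 1)) ≤ key (T (σ 2)) ∧ key (T (σ 2)) ≤ key (T (σ 3)) := by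
  rcases le_total (key (T 1)) (key (T 2)) with h12 | h21 <;>
    rcases le_total (key (T 2)) (key (T 3)) with h23 | h32 <;>
    rcases le_total (key (T 1)) (key (T 3)) with h13 | h31
  · exact ⟨1, rfl, h12, h23⟩
  · exact ⟨1, rfl, h12, h23⟩
  · -- 1 ≤ 3 ≤ 2
    refine ⟨Equiv.swap 2 3, by decide, ?_, ?_⟩
    · rw [show (Equiv.swap (2 : Fin 4) 3) 1 = 1 by decide, show (Equiv.swap (2 : Fin 4) 3) 2 = 3 by decide]
      exact h13
    · rw [show (Equiv.swap (2 : Fin 4) 3) 2 = 3 by decide, show (Equiv.swap (2 : Fin 4) 3) 3 = 2 by decide]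
      exact h32
  · -- 3 ≤ 1 ≤ 2
    refine ⟨(Equiv.swap 1 2).trans (Equiv.swap 2 3), by decide, ?_, ?_⟩
    · rw [show ((Equiv.swap (1 : Fin 4) 2).trans (Equiv.swap 2 3)) 1 = 3 by decide,
        show ((Equiv.swap (1 : Fin 4) 2).trans (Equiv.swap 2 3)) 2 = 1 by decide]
      exact h31
    · rw [show ((Equiv.swap (1 : Fin 4) 2).trans (Equiv.swap 2 3)) 2 = 1 by decide,
        show ((Equiv.swap (1 : Fin 4) 2).trans (Equiv.swap 2 3)) 3 = 2 by decide]
      exact h12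
  · -- 2 ≤ 1 ≤ 3
    refine ⟨Equiv.swap 1 2, by decide, ?_, ?_⟩
    · rw [show (Equiv.swap (1 : Fin 4) 2) 1 = 2 by decide, show (Equiv.swap (1 : Fin 4) 2) 2 = 1 by decide]
      exact h21
    · rw [show (Equiv.swap (1 : Fin 4) 2) 2 = 1 by decide, show (Equiv.swap (1 : Fin 4) 2) 3 = 3 by decide]
      exact h13
  · -- 2 ≤ 3 ≤ 1
    refine ⟨(Equiv.swap 2 3).trans (Equiv.swap 1 2), by decide, ?_, ?_⟩
    · rw [show ((Equiv.swap (2 : Fin 4) 3).trans (Equiv.swap 1 2)) 1 = 2 by decide,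
        show ((Equiv.swap (2 : Fin 4) 3).trans (Equiv.swap 1 2)) 2 = 3 by decide]
      exact h23
    · rw [show ((Equiv.swap (2 : Fin 4) 3).trans (Equiv.swap 1 2)) 2 = 3 by decide,
        show ((Equiv.swap (2 : Fin 4) 3).trans (Equiv.swap 1 2)) 3 = 1 by decide]
      exact h31
  · -- 3 ≤ 2 ≤ 1 (with 1 ≤ 3: all equal up to the chain; use the same relabelling)
    refine ⟨Equiv.swap 1 3, by decide, ?_, ?_⟩
    · rw [show (Equiv.swap (1 : Fin 4) 3) 1 = 3 by decide, show (Equiv.swap (1 : Fin 4) 3) 2 = 2 by decide]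
      exact h32
    · rw [show (Equiv.swap (1 : Fin 4) 3) 2 = 2 by decide, show (Equiv.swap (1 : Fin 4) 3) 3 = 1 by decide]
      exact h21
  · -- 3 ≤ 2 ≤ 1
    refine ⟨Equiv.swap 1 3, by decide, ?_, ?_⟩
    · rw [show (Equiv.swap (1 : Fin 4) 3) 1 = 3 by decide, show (Equiv.swap (1 : Fin 4) 3) 2 = 2 by decide]
      exact h32
    · rw [show (Equiv.swap (1 : Fin 4) 3) 2 = 2 by decide, show (Equiv.swap (1 : Fin 4) 3) 3 = 1 by decide]
      exact h21

omit [Fintype G] in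
/-- In a `SumTwo` quadruple of CM types, the conjugate of an embedding lying in corners `0` and `1` lies in corner `2`
(and in corner `3`): the cheap necessary condition that prunes the table. -/
theorem SumTwo.conj_mem_of_mem_inter {c : G} {T : Fin 4 → Finset G} (hT : SumTwo T) (h0 : IsCMType c (T 0))
    (h1 : IsCMType c (T 1)) : ∀ g ∈ T 0 ∩ T 1, c * g ∈ T 2 := by
  intro g hg
  rw [Finset.mem_inter] at hg
  have hx := hT (c * g)
  by_contra h2
  have hsub : (univ.filter fun i => c * g ∈ T i) ⊆ {3} := by
    intro i hi
    rw [mem_filter] at hi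
    rw [Finset.mem_singleton]
    fin_cases i
    · exact absurd hi.2 ((h0 g).1 hg.1)
    · exact absurd hi.2 ((h1 g).1 hg.2)
    · exact absurd hi.2 h2
    · rfl
  have := Finset.card_le_card hsub
  rw [hx, Finset.card_singleton] at this
  omega

/-! ### The cheap forms of the conditions, the powerset enumeration of the third corner -/

omit [Group G] [Fintype G] in
/-- In a `SumTwo` quadruple no embedding lies in the first three corners. -/
theorem SumTwo.inter3_eq_empty {T : Fin 4 → Finset G} (hT : SumTwo T) : T 0 ∩ T 1 ∩ T 2 = ∅ := by
  rw [Finset.eq_empty_iff_forall_notMem]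
  intro g hg
  simp only [Finset.mem_inter] at hg
  have h := hT g
  rw [Finset.card_filter, Fin.sum_univ_four, if_pos hg.1.1, if_pos hg.1.2, if_pos hg.2] at h
  split_ifs at h <;> omega

omit [Group G] in
/-- In a `SumTwo` quadruple every embedding lies in one of the first three corners. -/
theorem SumTwo.union3_eq_univ {T : Fin 4 → Finset G} (hT : SumTwo T) : T 0 ∪ T 1 ∪ T 2 = univ := by
  rw [Finset.eq_univ_iff_forall]
  intro g
  by_contra hg
  simp only [Finset.mem_union, not_or] at hg
  have h := hT g
  rw [Finset.card_filter, Fin.sum_univ_four, if_neg hg.1.1, if_neg hg.1.2, if_neg hg.2] at h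
  split_ifs at h <;> omega

/-- **Every two corners meet** — the cheap form of `ConjFree` on CM types. -/
def Intersecting (T : Fin 4 → Finset G) : Prop := ∀ i j : Fin 4, i ≠ j → (T i ∩ T j).Nonempty

/-- `Intersecting` is decidable. -/
instance (T : Fin 4 → Finset G) : Decidable (Intersecting T) := by
  unfold Intersecting
  infer_instance

/-- On CM types, conjugate-free quadruples are intersecting (two disjoint CM types are conjugate). -/
theorem ConjFree.intersecting {c : G} (hc : IsComplexConj c) {T : Fin 4 → Finset G}
    (hcm : ∀ i, IsCMType c (T i)) (h : ConjFree c T) : Intersecting T := by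
  intro i j hij
  by_contra hne
  rw [Finset.not_nonempty_iff_eq_empty, ← Finset.disjoint_iff_inter_eq_empty] at hne
  apply h i j hij
  rw [(hcm i).smul_eq_compl hc]
  refine Finset.eq_of_subset_of_card_le (Finset.subset_compl_iff_disjoint_left.2 hne) ?_
  rw [Finset.card_compl]
  have hi := (hcm i).two_mul_card hc
  have hj := (hcm j).two_mul_card hc
  omega

omit [Fintype G] in
/-- **The third corner of a `SumTwo` quadruple of CM types is `c (T₀ ∩ T₁) ∪ S ∪ c ((T₀ \ T₁) \ S)`** for
`S := T₂ ∩ (T₀ \ T₁)`: determined by its trace on the places where `T₀` and `T₁` differ. -/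
theorem SumTwo.two_eq {c : G} (hc : IsComplexConj c) {T : Fin 4 → Finset G} (hT : SumTwo T)
    (hcm : ∀ i, IsCMType c (T i)) :
    T 2 = c • (T 0 ∩ T 1) ∪ (T 2 ∩ (T 0 \ T 1)) ∪ c • ((T 0 \ T 1) \ (T 2 ∩ (T 0 \ T 1))) := by
  ext g
  simp only [Finset.mem_union, hc.mem_smul_iff, Finset.mem_inter, Finset.mem_sdiff, (hcm 0).conj_mem_iff,
    (hcm 1).conj_mem_iff, (hcm 2).conj_mem_iff]
  have h := hT g
  rw [Finset.card_filter, Fin.sum_univ_four] at h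
  by_cases h0 : g ∈ T 0 <;> by_cases h1 : g ∈ T 1 <;> by_cases h2 : g ∈ T 2 <;> by_cases h3 : g ∈ T 3 <;>
    simp only [h0, h1, h2, h3, if_true, if_false, not_true_eq_false, not_false_eq_true, and_true, and_false,
      or_false, or_true] at h ⊢ <;> omega

/-- `fun a acc => f a && acc` is left-commutative (`Multiset.foldr` needs it). -/
instance {α : Type} (f : α → Bool) : LeftCommutative fun (a : α) (acc : Bool) => f a && acc :=
  ⟨fun a b acc => Bool.and_left_comm (f a) (f b) acc⟩

/-- The Boolean «for all» over a multiset, as a fold (`Multiset.foldr`; the fold is well defined since `&&` is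
left-commutative). -/
def msetAll {α : Type} (f : α → Bool) (m : Multiset α) : Bool :=
  Multiset.foldr (fun a acc => f a && acc) true m

/-- `msetAll f m = true` gives `f a = true` for every `a ∈ m`. -/
theorem msetAll_eq_true {α : Type} {f : α → Bool} {m : Multiset α} (h : msetAll f m = true) :
    ∀ a ∈ m, f a = true := by
  induction m using Multiset.induction_on with
  | empty => intro a ha; exact absurd ha (Multiset.notMem_zero a)
  | cons b s ih =>
    unfold msetAll at h ih
    rw [Multiset.foldr_cons, Bool.and_eq_true] at h
    intro a ha
    rw [Multiset.mem_cons] at ha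
    rcases ha with rfl | ha
    · exact h.1
    · exact ih h.2 a ha

/-- The Boolean check of one triple `(T₀, T₁, T₂)` (with `T₃ := fourth T₀ T₁ T₂`): the key order, the cheap
`SumTwo` criterion, the cheap `ConjFree` criterion, then the value. -/
def quadCheck (key : Finset G → ℕ) (vals : List ℕ) (T₀ T₁ T₂ : Finset G) : Bool :=
  decide (key T₁ ≤ key T₂ → T₀ ∩ T₁ ∩ T₂ = ∅ → T₀ ∪ T₁ ∪ T₂ = univ → key T₂ ≤ key (fourth T₀ T₁ T₂) →
    Intersecting ![T₀, T₁, T₂, fourth T₀ T₁ T₂] → redDimFirst ![T₀, T₁, T₂, fourth T₀ T₁ T₂] ∈ vals)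

/-- The Boolean table of one `(G, c)`: `T₀` over `types1` (the CM types containing `1`), `T₁` over `types` (all CM
types), `T₂` over the `2^{|T₀ \ T₁|}` CM types `c (T₀ ∩ T₁) ∪ S ∪ c ((T₀ \ T₁) \ S)` compatible with `SumTwo`. -/
def quadTable (c : G) (key : Finset G → ℕ) (vals : List ℕ) (types1 types : List (Finset G)) : Bool :=
  types1.all fun T₀ => types.all fun T₁ =>
    msetAll (fun S => quadCheck key vals T₀ T₁ (c • (T₀ ∩ T₁) ∪ S ∪ c • ((T₀ \ T₁) \ S))) (T₀ \ T₁).powerset.val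

/-- **The bridge from the Boolean table to every conjugate-free `SumTwo` quadruple.**  `types1` contains every CM type
containing `1`, `types` every CM type.  Then every conjugate-free `SumTwo` quadruple `T` of CM types has
`redDim T ∈ vals`: translate by `t⁻¹` for `t ∈ T 0`, relabel by `exists_perm_key_sorted`, the third corner is one of
the enumerated ones (`SumTwo.two_eq`) and the fourth is forced (`SumTwo.three_eq_fourth`). -/
theorem redDim_of_sumTwo_mem_of_all {c : G} (hc : IsComplexConj c) (types1 types : List (Finset G))
    (h1 : ∀ Φ : Finset G, IsCMType c Φ → (1 : G) ∈ Φ → Φ ∈ types1)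
    (hall : ∀ Φ : Finset G, IsCMType c Φ → Φ ∈ types) (key : Finset G → ℕ) (vals : List ℕ)
    (htab : quadTable c key vals types1 types = true)
    (T : Fin 4 → Finset G) (hT : ∀ i, IsCMType c (T i)) (hsum : SumTwo T) (hconj : ConjFree c T) :
    redDim T ∈ vals := by
  unfold quadTable at htab
  simp only [List.all_eq_true] at htab
  obtain ⟨t, ht⟩ := Finset.nonempty_iff_ne_empty.2 (hT 0).ne_empty
  -- translate so that `1 ∈ T 0`
  set T' : Fin 4 → Finset G := fun i => t⁻¹ • T i with hT'
  have h1' : (1 : G) ∈ T' 0 := by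
    rw [hT', Finset.mem_inv_smul_finset_iff, smul_eq_mul, mul_one]
    exact ht
  have hT'cm : ∀ i, IsCMType c (T' i) := fun i => (hT i).smul hc t⁻¹
  have hsum' : SumTwo T' := hsum.smul t⁻¹
  have hconj' : ConjFree c T' := hconj.smul hc t⁻¹
  -- relabel so that the keys of corners 1, 2, 3 are sorted
  obtain ⟨σ, hσ0, hk12, hk23⟩ := exists_perm_key_sorted key T'
  have hUcm : ∀ i, IsCMType c ((T' ∘ σ) i) := fun i => hT'cm (σ i)
  have hUsum : SumTwo (T' ∘ σ) := hsum'.comp_perm σ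
  have hUconj : ConjFree c (T' ∘ σ) := hconj'.comp_perm σ
  have hU3 : (T' ∘ σ) 3 = fourth ((T' ∘ σ) 0) ((T' ∘ σ) 1) ((T' ∘ σ) 2) := hUsum.three_eq_fourth
  have hUeq : T' ∘ σ = ![(T' ∘ σ) 0, (T' ∘ σ) 1, (T' ∘ σ) 2, fourth ((T' ∘ σ) 0) ((T' ∘ σ) 1) ((T' ∘ σ) 2)] := by
    funext i
    fin_cases i
    · rfl
    · rfl
    · rfl
    · exact hU3
  have hU0 : (T' ∘ σ) 0 ∈ types1 := by
    refine h1 _ (hUcm 0) ?_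
    show (1 : G) ∈ T' (σ 0)
    rw [hσ0]
    exact h1'
  -- the third corner is one of the enumerated ones
  have hU2 := hUsum.two_eq hc hUcm
  have hS : (T' ∘ σ) 2 ∩ ((T' ∘ σ) 0 \ (T' ∘ σ) 1) ∈ ((T' ∘ σ) 0 \ (T' ∘ σ) 1).powerset :=
    Finset.mem_powerset.2 Finset.inter_subset_right
  have hchk := msetAll_eq_true (htab _ hU0 _ (hall _ (hUcm 1))) _ hS
  rw [← hU2] at hchk
  unfold quadCheck at hchk
  have key3 : key ((T' ∘ σ) 2) ≤ key (fourth ((T' ∘ σ) 0) ((T' ∘ σ) 1) ((T' ∘ σ) 2)) := by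
    rw [← hU3]
    exact hk23
  have hres := of_decide_eq_true hchk hk12 hUsum.inter3_eq_empty hUsum.union3_eq_univ key3
    (hUeq ▸ hUconj.intersecting hc hUcm)
  rw [← redDim_smul t⁻¹ T, ← redDim_comp_perm (fun i => t⁻¹ • T i) σ, redDim_eq_redDimFirst]
  exact hUeq ▸ hres

end Quads

end HodgeRepro
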